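import Literature.MathematicalPhysics.QuantumFieldTheory.Balaban1983to89.B9SectBGpReadingsY

/-!
# `Balaban1983to89.B9SectBGpReadingsYProd` — THE (3.42) READ OF THE AUGMENTED CODED FAMILY `KSC` AT AN ARBITRARY CODED CONFIGURATION,
# in particular at a coded PRODUCT `prod U a` (`W = e^{ηa}·U`, letters at the base `U`): `EBlock (KSC …) B δ c` ⇒ the four block
# majorants ([4] (2.51)) of `η²G′(dec c)`, `∇♯_{base c,k}·η²G′(dec c)`, `η²G′(dec c)·∇♯_{base c,k}`, `η⁻²Δ_{base c}·η²G′(dec c)` over the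
# frame's block map `blkC`

T. Bałaban, *Propagators for lattice gauge theories in a background field*, Commun. Math. Phys. **99** (1985) 389–434
[`Balaban1985BackgroundPropagators`, "B9"]; T. Bałaban, *Propagators and renormalization transformations for lattice gauge
theories. II*, Commun. Math. Phys. **96** (1984) 223–250 [`Balaban1984PropagatorsII`, "[4]"].

statement-level skeleton of published theorems with citation tags; proofs where landed; nothing here is a claim about the
Yang–Mills mass gap

WHY THIS FILE (pub-ymgap N06 row 13, seat dag-n06-c g8, INTENT-1 (b)).  `B9SectBGpReadingsY` (FILE 5, p571753) reads the augmented family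
`KSC G x par C37 C38` into block majorants AT A BASE `base U` only (`read342Y_KSC`, the frame's field `read342`, which is consumed at the
(3.35)-regular configurations — necessarily bases).  The OUTPUT half of the transfer (`B9SectBGpTransferOutY.thms_pullK_prod_of_KSC`, p578467)
receives `EBlock (KSC …) B₀ δ₀ (.prod U a)` — the block the Sect.-B frames WRITE at the coded product — and must convert its letters from
`U` to `W = U′U`; the first step of that conversion is to READ this block back into the four block-majorant families, with the covariant
differences and the Laplacian at the BASE `U = baseY (prod U a)` and the operator `G′` at the DECODING `W = decY (prod U a)`.  The proofs
are those of FILE 5 §2 verbatim with `(base U, U, U)` replaced by `(c, baseY c, decY c)`; nothing else changes because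
`kernelFamilySC_e_inl` is stated at every configuration.

WHAT THIS FILE PROVES (0 sorry, theorems only): §1 `liftY_bound_zero_cc ∕ _one_cc ∕ _two_cc ∕ _three_cc`, `eLatSC_le_of_eBlock_cc` — the
four pointwise readings at any coded `c`; §2 ★ `hasMajorant_letters_cc_of_eBlock` — the four block-majorant families over `blkC` with
constant `M₂(Σ_j‖b_j‖)·B₀` and the same rate (FILE 5's `hasMajorant_conj_of_liftY_bound`); ★★ `hasMajorant_letters_prod_of_eBlock` — the
same at `c = prod U a`, spelled with `UboxY U` and `GpY par (mulY (fluct η a) U)` (the shape `B9Eq370LetterConversion` consumes).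

HONEST SCOPE.  Finite-dimensional bookkeeping over NODE 00's DEFINED readings; no estimate of [B9] is proved or asserted; the block labels
`ιB` are a SECTION of `β` (`hι`), which exists exactly at the CORNER-FREE members (`B9BetaRangeKLevelV1.surjective_beta_iff`; bus LOCATED-7
of this seat: at a cornered member the record's carrier-block reading does not determine the step, by any labelling) — every statement
displaying `hι` is about corner-free members; COUNT-NEUTRAL; N06 NOT discharged; one finite lattice programme — nothing continuum ∕ OS ∕
mass-gap ∕ Clay.  Cell `pub-ymgap` (HUMAN RULING D-0062), Track A node N06 [B9], N06-ASSIGNMENT row 13, 2026-08-27.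

RELATED IN THE TREE, NOT DUPLICATED: `B9SectBGpReadingsY` (the base case and every helper used here BY NAME: `KSC`, `baseY`, `eLatSC`,
`kernelFamilySC_e_inl`, `etaS_eq_eta`, `suppIn_inl_of_blkC`, `supNorm_inl_le`, `exists_ball_bound(_eLatSC)`, `real_smul_fun`,
`hasMajorant_conj_of_liftY_bound`), `Node00.OpsYRead342` (def-Y's same-configuration dictionary for the record family `kernelFamilyS`),
`B9SectBGpTransferOutY` (the consumer's reduction of `hout` to `hconv`).
-/

noncomputable section

namespace Literature.MathematicalPhysics.QuantumFieldTheory.Balaban1983to89.B9SectBGpReadingsYProd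

open Literature.MathematicalPhysics.QuantumFieldTheory.Balaban1983to89.B6RandomWalk (HasMajorant BlockSupp)
open Literature.MathematicalPhysics.QuantumFieldTheory.Balaban1983to89.B9Eq352DivFormLetters (conj)
open Literature.MathematicalPhysics.QuantumFieldTheory.Balaban1983to89.Node00 (liftY liftY_apply)
open Literature.MathematicalPhysics.QuantumFieldTheory.Balaban1983to89.B6KLevelCensusIndexV1 (KIdx kGeo)
open Literature.MathematicalPhysics.QuantumFieldTheory.Balaban1983to89.B6Ineq2142KLevelV1 (β)
open Literature.MathematicalPhysics.QuantumFieldTheory.Balaban1983to89.B6Prop22KLevelCensusEta (epow)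
open Literature.MathematicalPhysics.QuantumFieldTheory.Balaban1983to89.B9Thm34Ext (toB6)
open Literature.MathematicalPhysics.QuantumFieldTheory.Balaban1983to89.B9FromB6 (EBlock)
open Literature.MathematicalPhysics.QuantumFieldTheory.Balaban1983to89.B9Eq39Adjoint (fluct)
open Literature.MathematicalPhysics.QuantumFieldTheory.Balaban1983to89.B9Eq352GradLetters (diffLetter)
open Literature.MathematicalPhysics.QuantumFieldTheory.Balaban1983to89.B9SectBCodedCarrier (CCfg)
open Literature.MathematicalPhysics.QuantumFieldTheory.Balaban1983to89.B9Eq360DeltaPrimeAY (AfldY blkY blkY_apply mulY)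
open Literature.MathematicalPhysics.QuantumFieldTheory.Balaban1983to89.B9PinMembersKLevelV1 (MemberY geo9Y bg9Y)
open Literature.MathematicalPhysics.QuantumFieldTheory.Balaban1983to89.B9SectBGpLettersY (decY GVal coordC blkC ΔpC GopC LapC)
open Literature.MathematicalPhysics.QuantumFieldTheory.Balaban1983to89.B9SectBGpFrameCodedY (codingYx)
open Literature.MathematicalPhysics.QuantumFieldTheory.Balaban1983to89.B9Thm314WholeExpansionReads (le_iSup_ball)
open Literature.MathematicalPhysics.QuantumFieldTheory.Balaban1983to89.B9SectBGpReadingsY (KSC baseY eLatSC kernelFamilySC_e_inl etaS_eq_eta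
  suppIn_inl_of_blkC supNorm_inl_le exists_ball_bound exists_ball_bound_eLatSC real_smul_fun norm_le_supBlkS norm_le_supBlkS'
  hasMajorant_conj_of_liftY_bound)
open Literature.MathematicalPhysics.QuantumFieldTheory.Balaban1983to89.Node00 (SiteY BlkY IBondY CfgY BallY SiteOpY SiteParY UboxY shiftY cdS cdsS lapS
  etaS supBlkS supBlkS' GpY)

variable {𝔸 : Type} [NormedRing 𝔸] [NormedAlgebra ℂ 𝔸]

/-! ## §1 The four pointwise readings at an arbitrary coded configuration -/

section Record

variable {d ℓ : ℕ} {hd : 1 ≤ d + 1} {hL : Odd (ℓ + 1) ∧ 1 < ℓ + 1} {b₀ b₁ : ℝ} {Mstar : ℕ} [CompleteSpace 𝔸] [FiniteDimensional ℝ 𝔸]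
  (G : Subgroup 𝔸ˣ) (x : MemberY d ℓ hd hL b₀ b₁ Mstar) (par : SiteParY 𝔸 x.toKIdx) {ι : Type} [Fintype ι] (b : Module.Basis ι ℝ 𝔸)
  (ιB : BlkY x.toKIdx → IBondY x.toKIdx) (C37 C38 : ℝ → CfgY 𝔸 x.toKIdx → AfldY 𝔸 x.toKIdx → Prop)

/-- ★ **ENTRY 0 OF THE READING**: the (3.42) block of the augmented family at ANY coded configuration `c` bounds `η²‖(G′(dec c)(f ⊗ E))(z)‖` for `f` supported in the labelled
block `y′`, `|f| ≦ B`, `‖E‖ ≦ 1`, by `(η/η_S)²·B₀·(Lʲη)²e^{−δd(y(z),y′)}·B`. [cite: Balaban1985BackgroundPropagators, (3.42) p.397 (first entry)] -/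
theorem liftY_bound_zero_cc (hι : ∀ s : BlkY x.toKIdx, β x.toKIdx.hN x.toKIdx.D x.toKIdx.hk (ιB s) = s) {c : CCfg (CfgY 𝔸 x.toKIdx) (AfldY 𝔸 x.toKIdx)} {B₀ δ : ℝ}
    (hB₀ : 0 ≤ B₀) (hE : EBlock (KSC G x par C37 C38) B₀ δ c)
    (f : SiteY x.toKIdx → ℝ) (E : 𝔸) (y' : IBondY x.toKIdx) (B : ℝ) (hE1 : ‖E‖ ≤ 1) (hB : 0 ≤ B)
    (hoff : ∀ z, blkC x.toKIdx ιB z ≠ y' → f z = 0) (hbd : ∀ z, |f z| ≤ B) (z : SiteY x.toKIdx) :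
    ‖(((kGeo x.toKIdx).eta ^ 2) • (GpY x.toKIdx par (decY x.toKIdx c)).restrictScalars ℝ) (liftY f E) z‖
      ≤ (B₀ * (geo9Y x).len (blkC x.toKIdx ιB z) ^ 2 * Real.exp (-(δ * (geo9Y x).dist (blkC x.toKIdx ιB z) y'))) * B := by
  set η := (kGeo x.toKIdx).eta with hηdef
  have hη0 : 0 < η := B9GeoLemma21KLevelV1.geo9K_eta_pos x.toKIdx
  have hblk : β x.toKIdx.hN x.toKIdx.D x.toKIdx.hk (blkC x.toKIdx ιB z) = blkY x.toKIdx z := by rw [blkC, hι]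
  -- the reading at the labelled block of `z`
  have hread := hE 0 (.inl f) (blkC x.toKIdx ιB z) y' (suppIn_inl_of_blkC x ιB hι hoff)
  rw [KSC, kernelFamilySC_e_inl, hblk] at hread
  have hpref : B9.pref4 ((geo9Y x).len (blkC x.toKIdx ιB z)) 0 = (geo9Y x).len (blkC x.toKIdx ιB z) ^ 2 := rfl
  have hep : epow 0 = 2 := rfl
  rw [hpref, hep, etaS_eq_eta] at hread
  -- the term: η²·‖(G′(U)(f ⊗ E))(z)‖
  have hval : (((kGeo x.toKIdx).eta ^ 2) • (GpY x.toKIdx par (decY x.toKIdx c)).restrictScalars ℝ) (liftY f E) z = (η ^ 2 : ℝ) • GpY x.toKIdx par (decY x.toKIdx c) (liftY f E) z := rfl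
  rw [hval, norm_smul, Real.norm_eq_abs, abs_of_nonneg (by positivity)]
  -- ‖(G′(U)(f ⊗ E))(z)‖ ≤ the block sup ≤ the sup over the ball
  obtain ⟨C, -, hC⟩ := exists_ball_bound x ((GpY x.toKIdx par (decY x.toKIdx c)).restrictScalars ℝ) f
  have h1 : ‖GpY x.toKIdx par (decY x.toKIdx c) (liftY f E) z‖ ≤ supBlkS x.toKIdx (blkY x.toKIdx z) (GpY x.toKIdx par (decY x.toKIdx c) (liftY f E)) :=
    norm_le_supBlkS x.toKIdx _ _ rfl
  have h2 : supBlkS x.toKIdx (blkY x.toKIdx z) (GpY x.toKIdx par (decY x.toKIdx c) (liftY f E))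
      ≤ ⨆ E' : BallY 𝔸, eLatSC x.toKIdx (GpY x.toKIdx par) (baseY x.toKIdx c) (decY x.toKIdx c) (liftY f (E' : 𝔸)) (blkY x.toKIdx z) 0 := by
    have := le_iSup_ball (A := fun E' : BallY 𝔸 => eLatSC x.toKIdx (GpY x.toKIdx par) (baseY x.toKIdx c) (decY x.toKIdx c) (liftY f (E' : 𝔸)) (blkY x.toKIdx z) 0)
      ⟨C, fun E' => B9Ineq349SiteComposite.supBlkS_le x.toKIdx _ _ (le_trans (norm_nonneg _) (hC E' z)) fun w _ => hC E' w⟩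
      ⟨E, mem_closedBall_zero_iff.2 hE1⟩
    exact this
  have hsup : (geo9Y x).supNorm (.inl f) ≤ B := supNorm_inl_le x hB hbd
  have h3 : η ^ 2 * (⨆ E' : BallY 𝔸, eLatSC x.toKIdx (GpY x.toKIdx par) (baseY x.toKIdx c) (decY x.toKIdx c) (liftY f (E' : 𝔸)) (blkY x.toKIdx z) 0)
      ≤ B₀ * (geo9Y x).len (blkC x.toKIdx ιB z) ^ 2 * Real.exp (-(δ * (geo9Y x).dist (blkC x.toKIdx ιB z) y')) * B :=
    hread.trans (mul_le_mul_of_nonneg_left hsup (by positivity))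
  calc η ^ 2 * ‖GpY x.toKIdx par (decY x.toKIdx c) (liftY f E) z‖
      ≤ η ^ 2 * ⨆ E' : BallY 𝔸, eLatSC x.toKIdx (GpY x.toKIdx par) (baseY x.toKIdx c) (decY x.toKIdx c) (liftY f (E' : 𝔸)) (blkY x.toKIdx z) 0 :=
        mul_le_mul_of_nonneg_left (h1.trans h2) (by positivity)
    _ ≤ _ := h3



/-- the reading of the augmented family at a coded configuration `c` (letters at `baseY c`, operator at `decY c`), read at the labelled block of `z`, unfolded and bounded by the (3.42) block hypothesis.
[cite: Balaban1985BackgroundPropagators, (3.42) p.397, bookkeeping] -/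
theorem eLatSC_le_of_eBlock_cc (hι : ∀ s : BlkY x.toKIdx, β x.toKIdx.hN x.toKIdx.D x.toKIdx.hk (ιB s) = s) {c : CCfg (CfgY 𝔸 x.toKIdx) (AfldY 𝔸 x.toKIdx)} {B₀ δ : ℝ}
    (hB₀ : 0 ≤ B₀) (hE : EBlock (KSC G x par C37 C38) B₀ δ c) (n : Fin 4)
    (f : SiteY x.toKIdx → ℝ) (E : 𝔸) (y' : IBondY x.toKIdx) (B : ℝ) (hE1 : ‖E‖ ≤ 1) (hB : 0 ≤ B)
    (hoff : ∀ z, blkC x.toKIdx ιB z ≠ y' → f z = 0) (hbd : ∀ z, |f z| ≤ B) (z : SiteY x.toKIdx) :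
    (kGeo x.toKIdx).eta ^ (epow n) * eLatSC x.toKIdx (GpY x.toKIdx par) (baseY x.toKIdx c) (decY x.toKIdx c) (liftY f E) (blkY x.toKIdx z) n
      ≤ B₀ * B9.pref4 ((geo9Y x).len (blkC x.toKIdx ιB z)) n * Real.exp (-(δ * (geo9Y x).dist (blkC x.toKIdx ιB z) y')) * B := by
  have hη0 : 0 < (kGeo x.toKIdx).eta := B9GeoLemma21KLevelV1.geo9K_eta_pos x.toKIdx
  have hblk : β x.toKIdx.hN x.toKIdx.D x.toKIdx.hk (blkC x.toKIdx ιB z) = blkY x.toKIdx z := by rw [blkC, hι]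
  have hread := hE n (.inl f) (blkC x.toKIdx ιB z) y' (suppIn_inl_of_blkC x ιB hι hoff)
  rw [KSC, kernelFamilySC_e_inl, hblk, etaS_eq_eta] at hread
  obtain ⟨C, hC⟩ := exists_ball_bound_eLatSC x (GpY x.toKIdx par) (baseY x.toKIdx c) (decY x.toKIdx c) f (blkY x.toKIdx z) n
  have h2 : eLatSC x.toKIdx (GpY x.toKIdx par) (baseY x.toKIdx c) (decY x.toKIdx c) (liftY f E) (blkY x.toKIdx z) n
      ≤ ⨆ E' : BallY 𝔸, eLatSC x.toKIdx (GpY x.toKIdx par) (baseY x.toKIdx c) (decY x.toKIdx c) (liftY f (E' : 𝔸)) (blkY x.toKIdx z) n :=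
    le_iSup_ball (A := fun E' : BallY 𝔸 => eLatSC x.toKIdx (GpY x.toKIdx par) (baseY x.toKIdx c) (decY x.toKIdx c) (liftY f (E' : 𝔸)) (blkY x.toKIdx z) n) ⟨C, hC⟩
      ⟨E, mem_closedBall_zero_iff.2 hE1⟩
  have hpref : 0 ≤ B9.pref4 ((geo9Y x).len (blkC x.toKIdx ιB z)) n := by
    have hl := (B9GeoLemma21KLevelV1.geo9Y_len_pos x (blkC x.toKIdx ιB z)).le
    match n with
    | 0 => exact pow_nonneg hl 2
    | 1 => exact hl
    | 2 => exact hl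
    | 3 => exact zero_le_one
  calc (kGeo x.toKIdx).eta ^ (epow n) * eLatSC x.toKIdx (GpY x.toKIdx par) (baseY x.toKIdx c) (decY x.toKIdx c) (liftY f E) (blkY x.toKIdx z) n
      ≤ (kGeo x.toKIdx).eta ^ (epow n) * ⨆ E' : BallY 𝔸, eLatSC x.toKIdx (GpY x.toKIdx par) (baseY x.toKIdx c) (decY x.toKIdx c) (liftY f (E' : 𝔸)) (blkY x.toKIdx z) n :=
        mul_le_mul_of_nonneg_left h2 (by positivity)
    _ ≤ B₀ * B9.pref4 ((geo9Y x).len (blkC x.toKIdx ιB z)) n * Real.exp (-(δ * (geo9Y x).dist (blkC x.toKIdx ιB z) y')) *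
          (geo9Y x).supNorm (.inl f) := hread
    _ ≤ _ := mul_le_mul_of_nonneg_left (supNorm_inl_le x hB hbd) (by positivity)

/-- ★ **ENTRY 1 OF THE READING** (left difference letters, forward AND backward): `‖(∇♯_{base c,k}·η²G′(dec c))(f ⊗ E)(z)‖ ≦ B₀(Lʲη)e^{−δd}·B` at any coded `c`.
[cite: Balaban1985BackgroundPropagators, (3.42) p.397 (second entry), (3.3) p.390, (3.8) p.392] -/
theorem liftY_bound_one_cc (hι : ∀ s : BlkY x.toKIdx, β x.toKIdx.hN x.toKIdx.D x.toKIdx.hk (ιB s) = s) {c : CCfg (CfgY 𝔸 x.toKIdx) (AfldY 𝔸 x.toKIdx)} {B₀ δ : ℝ}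
    (hB₀ : 0 ≤ B₀) (hE : EBlock (KSC G x par C37 C38) B₀ δ c) (k : Fin (d + 1) ⊕ Fin (d + 1))
    (f : SiteY x.toKIdx → ℝ) (E : 𝔸) (y' : IBondY x.toKIdx) (B : ℝ) (hE1 : ‖E‖ ≤ 1) (hB : 0 ≤ B)
    (hoff : ∀ z, blkC x.toKIdx ιB z ≠ y' → f z = 0) (hbd : ∀ z, |f z| ≤ B) (z : SiteY x.toKIdx) :
    ‖(diffLetter (shiftY x.toKIdx) (UboxY x.toKIdx (baseY x.toKIdx c)) ((((kGeo x.toKIdx).eta : ℂ))⁻¹) k *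
        (((kGeo x.toKIdx).eta ^ 2) • (GpY x.toKIdx par (decY x.toKIdx c)).restrictScalars ℝ)) (liftY f E) z‖
      ≤ (B₀ * (geo9Y x).len (blkC x.toKIdx ιB z) * Real.exp (-(δ * (geo9Y x).dist (blkC x.toKIdx ιB z) y'))) * B := by
  set η := (kGeo x.toKIdx).eta with hηdef
  have hη0 : 0 < η := B9GeoLemma21KLevelV1.geo9K_eta_pos x.toKIdx
  have key := eLatSC_le_of_eBlock_cc G x par ιB C37 C38 hι hB₀ hE 1 f E y' B hE1 hB hoff hbd z
  have hep : epow 1 = 1 := rfl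
  have hpref : B9.pref4 ((geo9Y x).len (blkC x.toKIdx ιB z)) 1 = (geo9Y x).len (blkC x.toKIdx ιB z) := rfl
  rw [hep, pow_one, hpref] at key
  -- the value of the letter product on `f ⊗ E` at `z`
  set Λ := GpY x.toKIdx par (decY x.toKIdx c) (liftY f E) with hΛ
  have hval : ∀ μ, (diffLetter (shiftY x.toKIdx) (UboxY x.toKIdx (baseY x.toKIdx c)) (((η : ℂ))⁻¹) (Sum.inl μ) *
        ((η ^ 2) • (GpY x.toKIdx par (decY x.toKIdx c)).restrictScalars ℝ)) (liftY f E) z = ((η : ℂ))⁻¹ • ((((η ^ 2 : ℝ)) : ℂ) • cdS x.toKIdx (baseY x.toKIdx c) μ Λ z) := by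
    intro μ
    rw [Module.End.mul_apply, B9Eq352GradLetters.diffLetter_inl, B9Eq352DivFormLetters.gradLetterF_apply, LinearMap.smul_apply,
      LinearMap.restrictScalars_apply, real_smul_fun, B9Eq39Adjoint.covD_smul]
    rfl
  have hval' : ∀ μ, (diffLetter (shiftY x.toKIdx) (UboxY x.toKIdx (baseY x.toKIdx c)) (((η : ℂ))⁻¹) (Sum.inr μ) *
        ((η ^ 2) • (GpY x.toKIdx par (decY x.toKIdx c)).restrictScalars ℝ)) (liftY f E) z = -(((η : ℂ))⁻¹ • ((((η ^ 2 : ℝ)) : ℂ) • cdsS x.toKIdx (baseY x.toKIdx c) μ Λ z)) := by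
    intro μ
    rw [Module.End.mul_apply, B9Eq352GradLetters.diffLetter_inr, LinearMap.neg_apply, Pi.neg_apply, B9Eq352DivFormLetters.gradLetterB_apply,
      LinearMap.smul_apply, LinearMap.restrictScalars_apply, real_smul_fun, B9Eq39Adjoint.covDstar_smul]
    rfl
  have hnorm : ∀ v : 𝔸, ‖((η : ℂ))⁻¹ • ((((η ^ 2 : ℝ)) : ℂ) • v)‖ = η * ‖v‖ := fun v => by
    rw [norm_smul, norm_smul, norm_inv, Complex.norm_real, Complex.norm_real, Real.norm_eq_abs, Real.norm_eq_abs, abs_of_pos hη0,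
      abs_of_nonneg (by positivity)]
    field_simp
  rcases k with μ | μ
  · rw [hval μ, hnorm]
    have h1 : ‖cdS x.toKIdx (baseY x.toKIdx c) μ Λ z‖ ≤ eLatSC x.toKIdx (GpY x.toKIdx par) (baseY x.toKIdx c) (decY x.toKIdx c) (liftY f E) (blkY x.toKIdx z) 1 :=
      (norm_le_supBlkS' x.toKIdx (blkY x.toKIdx z) (fun μ => cdS x.toKIdx (baseY x.toKIdx c) μ Λ) μ rfl).trans (le_max_left _ _)
    exact (mul_le_mul_of_nonneg_left h1 hη0.le).trans key
  · rw [hval' μ, norm_neg, hnorm]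
    have h1 : ‖cdsS x.toKIdx (baseY x.toKIdx c) μ Λ z‖ ≤ eLatSC x.toKIdx (GpY x.toKIdx par) (baseY x.toKIdx c) (decY x.toKIdx c) (liftY f E) (blkY x.toKIdx z) 1 :=
      (norm_le_supBlkS' x.toKIdx (blkY x.toKIdx z) (fun μ => cdsS x.toKIdx (baseY x.toKIdx c) μ Λ) μ rfl).trans (le_max_right _ _)
    exact (mul_le_mul_of_nonneg_left h1 hη0.le).trans key


/-- ★ **ENTRY 2 OF THE READING** (right difference letters, forward AND backward): `‖(η²G′(dec c)·∇♯_{base c,k})(f ⊗ E)(z)‖ ≦ B₀(Lʲη)e^{−δd}·B` at any coded `c`.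
[cite: Balaban1985BackgroundPropagators, (3.42) p.397 (third entry), (3.3) p.390, (3.8) p.392] -/
theorem liftY_bound_two_cc (hι : ∀ s : BlkY x.toKIdx, β x.toKIdx.hN x.toKIdx.D x.toKIdx.hk (ιB s) = s) {c : CCfg (CfgY 𝔸 x.toKIdx) (AfldY 𝔸 x.toKIdx)} {B₀ δ : ℝ}
    (hB₀ : 0 ≤ B₀) (hE : EBlock (KSC G x par C37 C38) B₀ δ c) (k : Fin (d + 1) ⊕ Fin (d + 1))
    (f : SiteY x.toKIdx → ℝ) (E : 𝔸) (y' : IBondY x.toKIdx) (B : ℝ) (hE1 : ‖E‖ ≤ 1) (hB : 0 ≤ B)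
    (hoff : ∀ z, blkC x.toKIdx ιB z ≠ y' → f z = 0) (hbd : ∀ z, |f z| ≤ B) (z : SiteY x.toKIdx) :
    ‖((((kGeo x.toKIdx).eta ^ 2) • (GpY x.toKIdx par (decY x.toKIdx c)).restrictScalars ℝ) *
        diffLetter (shiftY x.toKIdx) (UboxY x.toKIdx (baseY x.toKIdx c)) ((((kGeo x.toKIdx).eta : ℂ))⁻¹) k) (liftY f E) z‖
      ≤ (B₀ * (geo9Y x).len (blkC x.toKIdx ιB z) * Real.exp (-(δ * (geo9Y x).dist (blkC x.toKIdx ιB z) y'))) * B := by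
  set η := (kGeo x.toKIdx).eta with hηdef
  have hη0 : 0 < η := B9GeoLemma21KLevelV1.geo9K_eta_pos x.toKIdx
  have key := eLatSC_le_of_eBlock_cc G x par ιB C37 C38 hι hB₀ hE 2 f E y' B hE1 hB hoff hbd z
  have hep : epow 2 = 1 := rfl
  have hpref : B9.pref4 ((geo9Y x).len (blkC x.toKIdx ιB z)) 2 = (geo9Y x).len (blkC x.toKIdx ιB z) := rfl
  rw [hep, pow_one, hpref] at key
  set Λ₀ := liftY f E with hΛ₀
  have hF : ∀ μ, diffLetter (shiftY x.toKIdx) (UboxY x.toKIdx (baseY x.toKIdx c)) (((η : ℂ))⁻¹) (Sum.inl μ) Λ₀ = ((η : ℂ))⁻¹ • cdS x.toKIdx (baseY x.toKIdx c) μ Λ₀ := by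
    intro μ; funext w; rw [B9Eq352GradLetters.diffLetter_inl, B9Eq352DivFormLetters.gradLetterF_apply]; rfl
  have hB' : ∀ μ, diffLetter (shiftY x.toKIdx) (UboxY x.toKIdx (baseY x.toKIdx c)) (((η : ℂ))⁻¹) (Sum.inr μ) Λ₀ = -(((η : ℂ))⁻¹ • cdsS x.toKIdx (baseY x.toKIdx c) μ Λ₀) := by
    intro μ; funext w
    rw [B9Eq352GradLetters.diffLetter_inr, LinearMap.neg_apply, Pi.neg_apply, Pi.neg_apply, B9Eq352DivFormLetters.gradLetterB_apply]; rfl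
  have hval : ∀ μ, ((((η ^ 2)) • (GpY x.toKIdx par (decY x.toKIdx c)).restrictScalars ℝ) * diffLetter (shiftY x.toKIdx) (UboxY x.toKIdx (baseY x.toKIdx c)) (((η : ℂ))⁻¹) (Sum.inl μ))
        Λ₀ z = (η ^ 2 : ℝ) • (((η : ℂ))⁻¹ • GpY x.toKIdx par (decY x.toKIdx c) (cdS x.toKIdx (baseY x.toKIdx c) μ Λ₀) z) := by
    intro μ
    simp only [Module.End.mul_apply, hF, map_smul, LinearMap.smul_apply, LinearMap.restrictScalars_apply, Pi.smul_apply]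
  have hval' : ∀ μ, ((((η ^ 2)) • (GpY x.toKIdx par (decY x.toKIdx c)).restrictScalars ℝ) * diffLetter (shiftY x.toKIdx) (UboxY x.toKIdx (baseY x.toKIdx c)) (((η : ℂ))⁻¹) (Sum.inr μ))
        Λ₀ z = -((η ^ 2 : ℝ) • (((η : ℂ))⁻¹ • GpY x.toKIdx par (decY x.toKIdx c) (cdsS x.toKIdx (baseY x.toKIdx c) μ Λ₀) z)) := by
    intro μ
    simp only [Module.End.mul_apply, hB', map_neg, map_smul, LinearMap.smul_apply, LinearMap.restrictScalars_apply, Pi.neg_apply, Pi.smul_apply]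
  have hnorm : ∀ v : 𝔸, ‖(η ^ 2 : ℝ) • (((η : ℂ))⁻¹ • v)‖ = η * ‖v‖ := fun v => by
    rw [norm_smul, norm_smul, norm_inv, Complex.norm_real, Real.norm_eq_abs, Real.norm_eq_abs, abs_of_pos hη0, abs_of_nonneg (by positivity)]
    field_simp
  rcases k with μ | μ
  · rw [hval μ, hnorm]
    have h1 : ‖GpY x.toKIdx par (decY x.toKIdx c) (cdS x.toKIdx (baseY x.toKIdx c) μ Λ₀) z‖ ≤ eLatSC x.toKIdx (GpY x.toKIdx par) (baseY x.toKIdx c) (decY x.toKIdx c) Λ₀ (blkY x.toKIdx z) 2 :=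
      (norm_le_supBlkS' x.toKIdx (blkY x.toKIdx z) (fun μ => GpY x.toKIdx par (decY x.toKIdx c) (cdS x.toKIdx (baseY x.toKIdx c) μ Λ₀)) μ rfl).trans (le_max_left _ _)
    exact (mul_le_mul_of_nonneg_left h1 hη0.le).trans key
  · rw [hval' μ, norm_neg, hnorm]
    have h1 : ‖GpY x.toKIdx par (decY x.toKIdx c) (cdsS x.toKIdx (baseY x.toKIdx c) μ Λ₀) z‖ ≤ eLatSC x.toKIdx (GpY x.toKIdx par) (baseY x.toKIdx c) (decY x.toKIdx c) Λ₀ (blkY x.toKIdx z) 2 :=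
      (norm_le_supBlkS' x.toKIdx (blkY x.toKIdx z) (fun μ => GpY x.toKIdx par (decY x.toKIdx c) (cdsS x.toKIdx (baseY x.toKIdx c) μ Λ₀)) μ rfl).trans (le_max_right _ _)
    exact (mul_le_mul_of_nonneg_left h1 hη0.le).trans key

/-- ★ **ENTRY 3 OF THE READING** (the Laplacian letter): `‖(η⁻²Δ_{base c}·η²G′(dec c))(f ⊗ E)(z)‖ ≦ B₀e^{−δd}·B` at any coded `c`. [cite: Balaban1985BackgroundPropagators, (3.42) p.397 (fourth entry), (3.23) p.394] -/
theorem liftY_bound_three_cc (hι : ∀ s : BlkY x.toKIdx, β x.toKIdx.hN x.toKIdx.D x.toKIdx.hk (ιB s) = s) {c : CCfg (CfgY 𝔸 x.toKIdx) (AfldY 𝔸 x.toKIdx)} {B₀ δ : ℝ}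
    (hB₀ : 0 ≤ B₀) (hE : EBlock (KSC G x par C37 C38) B₀ δ c)
    (f : SiteY x.toKIdx → ℝ) (E : 𝔸) (y' : IBondY x.toKIdx) (B : ℝ) (hE1 : ‖E‖ ≤ 1) (hB : 0 ≤ B)
    (hoff : ∀ z, blkC x.toKIdx ιB z ≠ y' → f z = 0) (hbd : ∀ z, |f z| ≤ B) (z : SiteY x.toKIdx) :
    ‖((((kGeo x.toKIdx).eta ^ 2)⁻¹ • (Node00.lapSL x.toKIdx (baseY x.toKIdx c)).restrictScalars ℝ) *
        (((kGeo x.toKIdx).eta ^ 2) • (GpY x.toKIdx par (decY x.toKIdx c)).restrictScalars ℝ)) (liftY f E) z‖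
      ≤ (B₀ * 1 * Real.exp (-(δ * (geo9Y x).dist (blkC x.toKIdx ιB z) y'))) * B := by
  set η := (kGeo x.toKIdx).eta with hηdef
  have hη0 : 0 < η := B9GeoLemma21KLevelV1.geo9K_eta_pos x.toKIdx
  have hη2 : (η ^ 2 : ℝ) ≠ 0 := pow_ne_zero 2 hη0.ne'
  have key := eLatSC_le_of_eBlock_cc G x par ιB C37 C38 hι hB₀ hE 3 f E y' B hE1 hB hoff hbd z
  have hep : epow 3 = 0 := rfl
  have hpref : B9.pref4 ((geo9Y x).len (blkC x.toKIdx ιB z)) 3 = 1 := rfl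
  rw [hep, pow_zero, one_mul, hpref] at key
  set Λ := GpY x.toKIdx par (decY x.toKIdx c) (liftY f E) with hΛ
  have hval : ((((η ^ 2))⁻¹ • (Node00.lapSL x.toKIdx (baseY x.toKIdx c)).restrictScalars ℝ) * (((η ^ 2)) • (GpY x.toKIdx par (decY x.toKIdx c)).restrictScalars ℝ)) (liftY f E) z
      = lapS x.toKIdx (baseY x.toKIdx c) Λ z := by
    rw [Module.End.mul_apply, LinearMap.smul_apply, LinearMap.restrictScalars_apply, LinearMap.smul_apply, LinearMap.restrictScalars_apply,
      real_smul_fun (η ^ 2) (GpY x.toKIdx par (decY x.toKIdx c) (liftY f E)), LinearMap.map_smul_of_tower, Node00.lapSL_apply, ← hΛ, Pi.smul_apply, Pi.smul_apply,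
      ← Complex.coe_smul, smul_smul, ← Complex.ofReal_mul, inv_mul_cancel₀ hη2, Complex.ofReal_one, one_smul]
  rw [hval]
  have h1 : ‖lapS x.toKIdx (baseY x.toKIdx c) Λ z‖ ≤ eLatSC x.toKIdx (GpY x.toKIdx par) (baseY x.toKIdx c) (decY x.toKIdx c) (liftY f E) (blkY x.toKIdx z) 3 :=
    norm_le_supBlkS x.toKIdx (blkY x.toKIdx z) (lapS x.toKIdx (baseY x.toKIdx c) Λ) rfl
  exact h1.trans key


/-! ## §2 ★ The four block-majorant families at an arbitrary coded configuration, and at a coded product -/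

/-- ★ **THE (3.42) READ OF THE AUGMENTED FAMILY AT ANY CODED CONFIGURATION**: `EBlock (KSC …) B₀ δ c` gives, over the frame's block map `blkC`, the
block majorants `M₂(Σ_j‖b_j‖)·B₀·ℓ(a)^{(2,1,1,0)}·e^{−δd(a,a′)}` of the four conjugated letters `η²G′(dec c)`, `∇♯_{base c,k}·η²G′(dec c)` (every
`k ∈ κ ⊕ κ`), `η²G′(dec c)·∇♯_{base c,k}` (every `k`), `η⁻²Δ_{base c}·η²G′(dec c)` — the reading constant `c_R = M₂·Σ_j‖b_j‖` of FILE 5.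
[cite: Balaban1985BackgroundPropagators, (3.42) p.397, (3.39) p.397; Balaban1984PropagatorsII, (2.51) p.232] -/
theorem hasMajorant_letters_cc_of_eBlock [Fintype (geo9Y x).Site] {Rr : ℝ} {Hp : Prop}
    (hι : ∀ s : BlkY x.toKIdx, β x.toKIdx.hN x.toKIdx.D x.toKIdx.hk (ιB s) = s)
    (M₂ : ℝ) (hM₂ : 0 ≤ M₂) (hrepr : ∀ (v : 𝔸) (j : ι), |b.repr v j| ≤ M₂ * ‖v‖)
    {c : CCfg (CfgY 𝔸 x.toKIdx) (AfldY 𝔸 x.toKIdx)} {B₀ δ : ℝ} (hB₀ : 0 ≤ B₀) (hE : EBlock (KSC G x par C37 C38) B₀ δ c) :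
    HasMajorant (g := toB6 (geo9Y x) Rr Hp) (fun p : SiteY x.toKIdx × ι => blkC x.toKIdx ιB p.1)
        (conj b (((kGeo x.toKIdx).eta ^ 2) • (GpY x.toKIdx par (decY x.toKIdx c)).restrictScalars ℝ))
        (fun a a' => M₂ * (∑ j, ‖b j‖) * B₀ * (geo9Y x).len a ^ 2 * Real.exp (-(δ * (geo9Y x).dist a a'))) ∧
      (∀ k : Fin (d + 1) ⊕ Fin (d + 1), HasMajorant (g := toB6 (geo9Y x) Rr Hp) (fun p : SiteY x.toKIdx × ι => blkC x.toKIdx ιB p.1)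
        (conj b (diffLetter (shiftY x.toKIdx) (UboxY x.toKIdx (baseY x.toKIdx c)) ((((kGeo x.toKIdx).eta : ℂ))⁻¹) k) *
          conj b (((kGeo x.toKIdx).eta ^ 2) • (GpY x.toKIdx par (decY x.toKIdx c)).restrictScalars ℝ))
        (fun a a' => M₂ * (∑ j, ‖b j‖) * B₀ * (geo9Y x).len a * Real.exp (-(δ * (geo9Y x).dist a a')))) ∧
      (∀ k : Fin (d + 1) ⊕ Fin (d + 1), HasMajorant (g := toB6 (geo9Y x) Rr Hp) (fun p : SiteY x.toKIdx × ι => blkC x.toKIdx ιB p.1)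
        (conj b (((kGeo x.toKIdx).eta ^ 2) • (GpY x.toKIdx par (decY x.toKIdx c)).restrictScalars ℝ) *
          conj b (diffLetter (shiftY x.toKIdx) (UboxY x.toKIdx (baseY x.toKIdx c)) ((((kGeo x.toKIdx).eta : ℂ))⁻¹) k))
        (fun a a' => M₂ * (∑ j, ‖b j‖) * B₀ * (geo9Y x).len a * Real.exp (-(δ * (geo9Y x).dist a a')))) ∧
      HasMajorant (g := toB6 (geo9Y x) Rr Hp) (fun p : SiteY x.toKIdx × ι => blkC x.toKIdx ιB p.1)
        (conj b ((((kGeo x.toKIdx).eta ^ 2)⁻¹ • (Node00.lapSL x.toKIdx (baseY x.toKIdx c)).restrictScalars ℝ)) *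
          conj b (((kGeo x.toKIdx).eta ^ 2) • (GpY x.toKIdx par (decY x.toKIdx c)).restrictScalars ℝ))
        (fun a a' => M₂ * (∑ j, ‖b j‖) * B₀ * 1 * Real.exp (-(δ * (geo9Y x).dist a a'))) := by
  set η := (kGeo x.toKIdx).eta with hηdef
  refine ⟨?_, fun k => ?_, fun k => ?_, ?_⟩
  · have h := hasMajorant_conj_of_liftY_bound b (g := toB6 (geo9Y x) Rr Hp) (fun z => blkC x.toKIdx ιB z)
      ((η ^ 2) • (GpY x.toKIdx par (decY x.toKIdx c)).restrictScalars ℝ)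
      (fun a a' => B₀ * (geo9Y x).len a ^ 2 * Real.exp (-(δ * (geo9Y x).dist a a'))) M₂ hM₂ hrepr
      (fun f E y' B hE1 hB hoff hbd z => liftY_bound_zero_cc G x par ιB C37 C38 hι hB₀ hE f E y' B hE1 hB hoff hbd z)
    intro y' μ B hμ p
    exact (h y' μ B hμ p).trans (le_of_eq (by ring))
  · have h := hasMajorant_conj_of_liftY_bound b (g := toB6 (geo9Y x) Rr Hp) (fun z => blkC x.toKIdx ιB z)
      (diffLetter (shiftY x.toKIdx) (UboxY x.toKIdx (baseY x.toKIdx c)) (((η : ℂ))⁻¹) k *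
        ((η ^ 2) • (GpY x.toKIdx par (decY x.toKIdx c)).restrictScalars ℝ))
      (fun a a' => B₀ * (geo9Y x).len a * Real.exp (-(δ * (geo9Y x).dist a a'))) M₂ hM₂ hrepr
      (fun f E y' B hE1 hB hoff hbd z => liftY_bound_one_cc G x par ιB C37 C38 hι hB₀ hE k f E y' B hE1 hB hoff hbd z)
    rw [B9Eq352DivFormLetters.conj_mul] at h
    intro y' μ B hμ p
    exact (h y' μ B hμ p).trans (le_of_eq (by ring))
  · have h := hasMajorant_conj_of_liftY_bound b (g := toB6 (geo9Y x) Rr Hp) (fun z => blkC x.toKIdx ιB z)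
      (((η ^ 2) • (GpY x.toKIdx par (decY x.toKIdx c)).restrictScalars ℝ) *
        diffLetter (shiftY x.toKIdx) (UboxY x.toKIdx (baseY x.toKIdx c)) (((η : ℂ))⁻¹) k)
      (fun a a' => B₀ * (geo9Y x).len a * Real.exp (-(δ * (geo9Y x).dist a a'))) M₂ hM₂ hrepr
      (fun f E y' B hE1 hB hoff hbd z => liftY_bound_two_cc G x par ιB C37 C38 hι hB₀ hE k f E y' B hE1 hB hoff hbd z)
    rw [B9Eq352DivFormLetters.conj_mul] at h
    intro y' μ B hμ p
    exact (h y' μ B hμ p).trans (le_of_eq (by ring))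
  · have h := hasMajorant_conj_of_liftY_bound b (g := toB6 (geo9Y x) Rr Hp) (fun z => blkC x.toKIdx ιB z)
      ((((η ^ 2))⁻¹ • (Node00.lapSL x.toKIdx (baseY x.toKIdx c)).restrictScalars ℝ) *
        ((η ^ 2) • (GpY x.toKIdx par (decY x.toKIdx c)).restrictScalars ℝ))
      (fun a a' => B₀ * 1 * Real.exp (-(δ * (geo9Y x).dist a a'))) M₂ hM₂ hrepr
      (fun f E y' B hE1 hB hoff hbd z => liftY_bound_three_cc G x par ιB C37 C38 hι hB₀ hE f E y' B hE1 hB hoff hbd z)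
    rw [B9Eq352DivFormLetters.conj_mul] at h
    intro y' μ B hμ p
    exact (h y' μ B hμ p).trans (le_of_eq (by ring))

/-- ★★ **THE (3.42) READ AT A CODED PRODUCT `prod U a`** (`W = e^{ηa}·U`, `η = (kGeo x).eta`): `EBlock (KSC …) B₀ δ (.prod U a)` gives, over `blkC`,
the block majorants `M₂(Σ_j‖b_j‖)·B₀·ℓ(a)^{(2,1,1,0)}·e^{−δd}` of `η²G′(W)`, `∇♯_{U,k}·η²G′(W)`, `η²G′(W)·∇♯_{U,k}` (every `k ∈ κ ⊕ κ`) and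
`η⁻²Δ_U·η²G′(W)` — the block the Sect.-B frames write at the product, read back with ITS letters (at the base `U`); the input of the letter
conversion `U ↦ U′U` (`B9Eq370LetterConversion`). [cite: Balaban1985BackgroundPropagators, (3.42) p.397, Thm 3.4 p.400, p.403 l.1–9; Balaban1984PropagatorsII, (2.51) p.232] -/
theorem hasMajorant_letters_prod_of_eBlock [Fintype (geo9Y x).Site] {Rr : ℝ} {Hp : Prop}
    (hι : ∀ s : BlkY x.toKIdx, β x.toKIdx.hN x.toKIdx.D x.toKIdx.hk (ιB s) = s)
    (M₂ : ℝ) (hM₂ : 0 ≤ M₂) (hrepr : ∀ (v : 𝔸) (j : ι), |b.repr v j| ≤ M₂ * ‖v‖)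
    (U : CfgY 𝔸 x.toKIdx) (a : AfldY 𝔸 x.toKIdx) {B₀ δ : ℝ} (hB₀ : 0 ≤ B₀) (hE : EBlock (KSC G x par C37 C38) B₀ δ (.prod U a)) :
    HasMajorant (g := toB6 (geo9Y x) Rr Hp) (fun p : SiteY x.toKIdx × ι => blkC x.toKIdx ιB p.1)
        (conj b (((kGeo x.toKIdx).eta ^ 2) • (GpY x.toKIdx par (mulY x.toKIdx (fluct (kGeo x.toKIdx).eta a) U)).restrictScalars ℝ))
        (fun a a' => M₂ * (∑ j, ‖b j‖) * B₀ * (geo9Y x).len a ^ 2 * Real.exp (-(δ * (geo9Y x).dist a a'))) ∧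
      (∀ k : Fin (d + 1) ⊕ Fin (d + 1), HasMajorant (g := toB6 (geo9Y x) Rr Hp) (fun p : SiteY x.toKIdx × ι => blkC x.toKIdx ιB p.1)
        (conj b (diffLetter (shiftY x.toKIdx) (UboxY x.toKIdx U) ((((kGeo x.toKIdx).eta : ℂ))⁻¹) k) *
          conj b (((kGeo x.toKIdx).eta ^ 2) • (GpY x.toKIdx par (mulY x.toKIdx (fluct (kGeo x.toKIdx).eta a) U)).restrictScalars ℝ))
        (fun a a' => M₂ * (∑ j, ‖b j‖) * B₀ * (geo9Y x).len a * Real.exp (-(δ * (geo9Y x).dist a a')))) ∧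
      (∀ k : Fin (d + 1) ⊕ Fin (d + 1), HasMajorant (g := toB6 (geo9Y x) Rr Hp) (fun p : SiteY x.toKIdx × ι => blkC x.toKIdx ιB p.1)
        (conj b (((kGeo x.toKIdx).eta ^ 2) • (GpY x.toKIdx par (mulY x.toKIdx (fluct (kGeo x.toKIdx).eta a) U)).restrictScalars ℝ) *
          conj b (diffLetter (shiftY x.toKIdx) (UboxY x.toKIdx U) ((((kGeo x.toKIdx).eta : ℂ))⁻¹) k))
        (fun a a' => M₂ * (∑ j, ‖b j‖) * B₀ * (geo9Y x).len a * Real.exp (-(δ * (geo9Y x).dist a a')))) ∧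
      HasMajorant (g := toB6 (geo9Y x) Rr Hp) (fun p : SiteY x.toKIdx × ι => blkC x.toKIdx ιB p.1)
        (conj b ((((kGeo x.toKIdx).eta ^ 2)⁻¹ • (Node00.lapSL x.toKIdx U).restrictScalars ℝ)) *
          conj b (((kGeo x.toKIdx).eta ^ 2) • (GpY x.toKIdx par (mulY x.toKIdx (fluct (kGeo x.toKIdx).eta a) U)).restrictScalars ℝ))
        (fun a a' => M₂ * (∑ j, ‖b j‖) * B₀ * 1 * Real.exp (-(δ * (geo9Y x).dist a a'))) := by
  have h := hasMajorant_letters_cc_of_eBlock G x par b ιB C37 C38 (Rr := Rr) (Hp := Hp) hι M₂ hM₂ hrepr hB₀ hE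
  simp only [baseY] at h
  exact h

end Record

end Literature.MathematicalPhysics.QuantumFieldTheory.Balaban1983to89.B9SectBGpReadingsYProd
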